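import Summits.KontsevichZagierPeriods.KontsevichZagierPeriods.Theorems.LinRedNormalFormArrangementNormalFormSeparateThreeGrid
import Summits.KontsevichZagierPeriods.KontsevichZagierPeriods.Theorems.LinRedNormalFormArrangementNormalFormSeparateHighFanActive
import Summits.KontsevichZagierPeriods.KontsevichZagierPeriods.Theorems.LinRedNormalFormArrangementNormalFormSeparateHighCandidates
import Summits.KontsevichZagierPeriods.KontsevichZagierPeriods.Theorems.LinRedNormalFormArrangementNormalFormSeparateBaseChange

/-!
# `stub_separateThreeZero` for thin data, modulo `hHI₃` (part `Thin`)

(Line `janus-bands`, crux `ArrangementNormalForm`, stub `stub_separateThreeZero` — fibre-free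
separation over a bounded rational polytope in `ℝ³`, `JJ 3 0 → closure (GG 2 1 0)`; part `Thin`,
registered as `separateThreeZero_of_hI3_thin`.)

**Theorem** (`separateThreeZero_of_hI3_thin`). A literal `JJ 3 0` datum (bounded open rational
polytope `D ⊂ ℝ³`, integrand `P/∏ L_j^{e_j}`, absolutely convergent) whose active letters are
THIN — the zero plane of every `L_j` with `e_j ≠ 0` meets `D̄` inside a line (no 2-dimensional
contact; automatic when the plane neither meets `D` nor contains a facet of `D̄`, i.e. when the
convergence is not bought by a cancellable letter) — is congruent modulo `KZ.relations` to a
`ℤ`-combination of elements of `GG 2 1 0`, GIVEN the dimension-3 termwise-convergence lemma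
`hHI₃` (`separateThree_hI`, its registered statement universally closed).

Proof = the 3-d far-first engine: `separateHigh_fan_active` (pieces `D₁ ⊆ D` with a rational
direction `v` moving every active letter, non-vanishing and RATIO conditions), the base change
`separatePos_baseChange` along `v` (`SepHigh.dirAinv`), transport of thinness to the new
coordinates (the reference set `K₀` is the preimage of `D̄`), and `SepThree.grid` (grid finer
than the special points, contact-aware engine `SepThree.sepC_induction` with the splitting rule,
terminal Taylor split under the rim condition). What is left of the stub besides `hHI₃` is the
CANCELLATION lemma: every `JJ 3 0` datum is congruent to a thin one (divide `P` by the letters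
whose plane meets `D̄` in a 2-dimensional set, which absolute convergence forces to divide `P`).
-/

noncomputable section

open Set MeasureTheory Filter Topology

namespace Summit.KontsevichZagierPeriods.ArrangementNormalForm.JanusBands

open Literature.NumberTheory.Transcendental

namespace SepThree

open SeparatePos SepHigh MvPolynomial

/-- The inverse base substitution `Φ (x, t) = (A x, t)`. -/
theorem baseSub_inv {B k : ℕ} (A Ainv : Matrix (Fin B) (Fin B) ℚ) (hA' : Ainv * A = 1)
    (hA : A * Ainv = 1) (w : Fin (B + k) → ℝ) :
    (Fin.append (fun j => ∑ i, (A j i : ℝ) * (Fin.append (fun j => ∑ i, (Ainv j i : ℝ) *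
      w (Fin.castAdd k i)) (fun i => w (Fin.natAdd B i)) : Fin (B + k) → ℝ) (Fin.castAdd k i))
      (fun i => (Fin.append (fun j => ∑ i, (Ainv j i : ℝ) * w (Fin.castAdd k i))
        (fun i => w (Fin.natAdd B i)) : Fin (B + k) → ℝ) (Fin.natAdd B i)) : Fin (B + k) → ℝ) = w := by
  have _ := hA'
  funext l
  refine Fin.addCases (fun j => ?_) (fun i => ?_) l
  · simp only [Fin.append_left]
    exact sum_mul_sum_eq_self A Ainv hA _ j
  · simp

/-- The inverse base substitution is affine-linear along lines. -/
theorem baseSub_line {B k : ℕ} (A : Matrix (Fin B) (Fin B) ℚ) (P u : Fin (B + k) → ℝ) (t : ℝ) :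
    (Fin.append (fun j => ∑ i, (A j i : ℝ) * (P + t • u) (Fin.castAdd k i))
      (fun i => (P + t • u) (Fin.natAdd B i)) : Fin (B + k) → ℝ) =
    (Fin.append (fun j => ∑ i, (A j i : ℝ) * P (Fin.castAdd k i)) (fun i => P (Fin.natAdd B i)) :
      Fin (B + k) → ℝ) + t • (Fin.append (fun j => ∑ i, (A j i : ℝ) * u (Fin.castAdd k i))
      (fun i => u (Fin.natAdd B i)) : Fin (B + k) → ℝ) := by
  funext l
  refine Fin.addCases (fun j => ?_) (fun i => ?_) l
  · simp only [Fin.append_left, Pi.add_apply, Pi.smul_apply, smul_eq_mul, mul_add,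
      Finset.sum_add_distrib, Finset.mul_sum]
    refine congrArg (_ + ·) (Finset.sum_congr rfl fun i _ => by ring)
  · simp

end SepThree

open SeparatePos SepHigh SepThree in
/-- **`stub_separateThreeZero` for THIN data, modulo `hHI₃`** (registered part
`separateThreeZero_of_hI3_thin`): see the module docstring. -/
theorem separateThreeZero_of_hI3_thin (hHI₃ : ∀ (b k m m' n : ℕ) (s : KZ.IntegralRep (b + 1 + k)) (M : Fin m' → (Fin (b + 1) → ℚ) × ℚ) (L : Fin m → (Fin b → ℚ) × ℚ) (e : Fin m → ℕ) (p : MvPolynomial (Fin (b + 1)) ℚ) (ℓ : (Fin b → ℚ) × ℚ) (a : Fin k → Option ((Fin (b + 1) → ℚ) × ℚ)) (lo hi : Fin k → Fin k ⊕ ((Fin (b + 1) → ℚ) × ℚ)) (hpole : n ≠ 0 → ∀ z ∈ s.domain, (z (Fin.castAdd k (Fin.last b)) - (∑ i, (ℓ.1 i : ℝ) * z (Fin.castAdd k (Fin.castSucc i)) + (ℓ.2 : ℝ))) ≠ 0) (hbd : Bornology.IsBounded s.domain) (hdom : s.domain = {z | (∀ j, 0 < ∑ i, ((M j).1 i : ℝ)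 * z (Fin.castAdd k i) + ((M j).2 : ℝ)) ∧ ∀ i, Sum.elim (fun j => z (Fin.natAdd (b + 1) j)) (fun c => ∑ i', (c.1 i' : ℝ) * z (Fin.castAdd k i') + (c.2 : ℝ)) (lo i) < z (Fin.natAdd (b + 1) i) ∧ z (Fin.natAdd (b + 1) i) < Sum.elim (fun j => z (Fin.natAdd (b + 1) j)) (fun c => ∑ i', (c.1 i' : ℝ) * z (Fin.castAdd k i') + (c.2 : ℝ)) (hi i)}) (hint : EqOn s.integrand (fun z => MvPolynomial.aeval (fun i => z (Fin.castAdd k i)) p / (∏ j, (∑ i, ((L j).1 i : ℝ) * z (Fin.castAdd k (Fin.castSucc i)) + ((L j).2 : ℝ)) ^ e j) * (1 / (z (Fin.castAdd k (Fin.last b)) - (∑ i, (ℓ.1 i : ℝ) * z (Fin.castAdd k (Fin.castSucc i)) + (ℓ.2 : ℝ))) ^ n) * ∏ i, (a i).elim 1 (fun c => 1 / (z (Fin.natAdd (b + 1) i) - (∑ i', (c.1 i' : ℝ) * z (Fin.castAdd k i') + (c.2 : ℝ))))) s.domain) (N : ℕ) (q : ℕ → MvPolynomial (Fin b) ℚ)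 (hq : ∀ z : Fin (b + 1 + k) → ℝ, MvPolynomial.aeval (fun i => z (Fin.castAdd k i)) p = ∑ i ∈ Finset.range N, MvPolynomial.aeval (fun i => z (Fin.castAdd k (Fin.castSucc i))) (q i) * (z (Fin.castAdd k (Fin.last b)) - (∑ i, (ℓ.1 i : ℝ) * z (Fin.castAdd k (Fin.castSucc i)) + (ℓ.2 : ℝ))) ^ i) (hb : b = 2) (hk : k = 0) (hR : ∀ z ∈ closure s.domain, (∃ j, e j ≠ 0 ∧ (∑ i, ((L j).1 i : ℝ) * z (Fin.castAdd k (Fin.castSucc i)) + ((L j).2 : ℝ)) = 0) → (n ≠ 0 ∧ z (Fin.castAdd k (Fin.last b)) = ∑ i, (ℓ.1 i : ℝ) * z (Fin.castAdd k (Fin.castSucc i)) + (ℓ.2 : ℝ)) ∨ (∃ z' ∈ closure s.domain, z' ≠ z ∧ ∀ i : Fin b, z' (Fin.castAdd k (Fin.castSucc i)) = z (Fin.castAdd k (Fin.castSucc i)))), ∀ i ∈ Finset.range N, IntegrableOn (fun z => MvPolynomial.aeval (fun i => z (Fin.castAdd k (Fin.castSucc i))) (q i) / (∏ j, (∑ i,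 ((L j).1 i : ℝ) * z (Fin.castAdd k (Fin.castSucc i)) + ((L j).2 : ℝ)) ^ e j) * ((z (Fin.castAdd k (Fin.last b)) - (∑ i, (ℓ.1 i : ℝ) * z (Fin.castAdd k (Fin.castSucc i)) + (ℓ.2 : ℝ))) ^ i / (z (Fin.castAdd k (Fin.last b)) - (∑ i, (ℓ.1 i : ℝ) * z (Fin.castAdd k (Fin.castSucc i)) + (ℓ.2 : ℝ))) ^ n) * ∏ i, (a i).elim 1 (fun c => 1 / (z (Fin.natAdd (b + 1) i) - (∑ i', (c.1 i' : ℝ) * z (Fin.castAdd k i') + (c.2 : ℝ))))) s.domain) (m m' : ℕ) (s : KZ.IntegralRep (3 + 0)) (M : Fin m' → (Fin 3 → ℚ) × ℚ) (L : Fin m → (Fin 3 → ℚ) × ℚ) (e : Fin m → ℕ) (p : MvPolynomial (Fin 3) ℚ) (a : Fin 0 → Option ((Fin 3 → ℚ) × ℚ)) (lo hi : Fin 0 → Fin 0 ⊕ ((Fin 3 → ℚ) × ℚ)) (hbd : Bornology.IsBounded s.domain) (hdom : s.domain = {z | (∀ j, 0 < ∑ i, ((M j).1 i : ℝ) * z (Fin.castAdd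 0 i) + ((M j).2 : ℝ)) ∧ ∀ i, Sum.elim (fun j => z (Fin.natAdd 3 j)) (fun c => ∑ i', (c.1 i' : ℝ) * z (Fin.castAdd 0 i') + (c.2 : ℝ)) (lo i) < z (Fin.natAdd 3 i) ∧ z (Fin.natAdd 3 i) < Sum.elim (fun j => z (Fin.natAdd 3 j)) (fun c => ∑ i', (c.1 i' : ℝ) * z (Fin.castAdd 0 i') + (c.2 : ℝ)) (hi i)}) (hint : EqOn s.integrand (fun z => MvPolynomial.aeval (fun i => z (Fin.castAdd 0 i)) p / (∏ j, (∑ i, ((L j).1 i : ℝ) * z (Fin.castAdd 0 i) + ((L j).2 : ℝ)) ^ e j) * ∏ i, (a i).elim 1 (fun c => 1 / (z (Fin.natAdd 3 i) - (∑ i', (c.1 i' : ℝ) * z (Fin.castAdd 0 i') + (c.2 : ℝ))))) s.domain) (hthin : ∀ j, e j ≠ 0 → ∃ P u : Fin (3 + 0) → ℝ, ∀ z ∈ closure s.domain, (∑ i, ((L j).1 i : ℝ) * z (Fin.castAdd 0 i) + ((L j).2 : ℝ)) = 0 → ∃ t : ℝ, z = P + t • u) : ∃ c ∈ AddSubgroup.closure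 (SeparatePos.GGset 2 1 0), KZ.of s - c ∈ KZ.relations := by
  classical
  obtain ⟨c, hc, hrel⟩ := separateHigh_fan_active 1 0 m m' s M L e p a lo hi hbd hdom hint
  -- it suffices to treat one fan piece
  suffices hpiece : ∀ w ∈ {w : KZ.FormalRep | ∃ (m₁ : ℕ) (M₁ : Fin m₁ → (Fin (1 + 2) → ℚ) × ℚ)
      (s₁ : KZ.IntegralRep (1 + 2 + 0)) (v : Fin (1 + 2) → ℚ), v (Fin.last (1 + 1)) ≠ 0 ∧
      Bornology.IsBounded s₁.domain ∧
      s₁.domain = {z | (∀ j, 0 < ∑ i, ((M₁ j).1 i : ℝ) * z (Fin.castAdd 0 i) + ((M₁ j).2 : ℝ)) ∧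
        ∀ i, Sum.elim (fun j => z (Fin.natAdd (1 + 2) j)) (fun c => ∑ i', (c.1 i' : ℝ) *
          z (Fin.castAdd 0 i') + (c.2 : ℝ)) (lo i) < z (Fin.natAdd (1 + 2) i) ∧
          z (Fin.natAdd (1 + 2) i) < Sum.elim (fun j => z (Fin.natAdd (1 + 2) j))
          (fun c => ∑ i', (c.1 i' : ℝ) * z (Fin.castAdd 0 i') + (c.2 : ℝ)) (hi i)} ∧
      EqOn s₁.integrand (fun z => MvPolynomial.aeval (fun i => z (Fin.castAdd 0 i)) p /
        (∏ j, (∑ i, ((L j).1 i : ℝ) * z (Fin.castAdd 0 i) + ((L j).2 : ℝ)) ^ e j) *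
        ∏ i, (a i).elim 1 (fun c => 1 / (z (Fin.natAdd (1 + 2) i) -
          (∑ i', (c.1 i' : ℝ) * z (Fin.castAdd 0 i') + (c.2 : ℝ))))) s₁.domain ∧
      s₁.domain ⊆ s.domain ∧
      (∀ j, e j ≠ 0 → (L j).1 ≠ 0 → (∑ i, (L j).1 i * v i) ≠ 0) ∧
      (∀ j, (∑ i, (L j).1 i * v i) ≠ 0 → e j ≠ 0 → ∀ z ∈ s₁.domain,
        ∑ i, ((L j).1 i : ℝ) * z (Fin.castAdd 0 i) + ((L j).2 : ℝ) ≠ 0) ∧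
      (∀ j j', (∑ i, (L j).1 i * v i) ≠ 0 → (∑ i, (L j').1 i * v i) ≠ 0 → e j ≠ 0 → e j' ≠ 0 →
        (∑ i, (L j').1 i * v i) • L j ≠ (∑ i, (L j).1 i * v i) • L j' →
        ∃ C : ℝ, ∀ z ∈ s₁.domain, |∑ i, ((L j').1 i : ℝ) * z (Fin.castAdd 0 i) + ((L j').2 : ℝ)| ≤
          C * |(((∑ i, (L j).1 i * v i) : ℚ) : ℝ) * (∑ i, ((L j').1 i : ℝ) * z (Fin.castAdd 0 i) +
            ((L j').2 : ℝ)) - (((∑ i, (L j').1 i * v i) : ℚ) : ℝ) *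
            (∑ i, ((L j).1 i : ℝ) * z (Fin.castAdd 0 i) + ((L j).2 : ℝ))|) ∧
      w = KZ.of s₁}, ∃ c' ∈ AddSubgroup.closure (GGset 2 1 0), w - c' ∈ KZ.relations by
    obtain ⟨c', hc', hcc⟩ := SepTwoZero.closure_transfer' hpiece c hc
    refine ⟨c', hc', ?_⟩
    have := add_mem hrel hcc
    rwa [sub_add_sub_cancel] at this
  rintro w ⟨m₁, M₁, s₁, v, hv, hbd₁, hdom₁, hint₁, hsub, hactv, hpolev, hratv, rfl⟩
  -- the base change along `v`
  obtain ⟨hA', hA⟩ := dirAinv_mul_inv (n := 1 + 1) v hv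
  obtain ⟨M', L', p', a', lo', hi', s', -, hL', -, -, -, -, hΨ, hbd', hdom', hint', hrel'⟩ :=
    separatePos_baseChange (1 + 2) 0 m m₁ s₁ M₁ L e p a lo hi hbd₁ hdom₁ hint₁ (dirAinv v)⁻¹
      (dirAinv v) hA hA'
  -- the substitution and its inverse
  set Ψ : (Fin (1 + 2 + 0) → ℝ) → (Fin (1 + 2 + 0) → ℝ) := fun w =>
    Fin.append (fun j => ∑ i, (dirAinv v j i : ℝ) * w (Fin.castAdd 0 i))
      (fun i => w (Fin.natAdd (1 + 2) i)) with hΨdef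
  set Φ : (Fin (1 + 2 + 0) → ℝ) → (Fin (1 + 2 + 0) → ℝ) := fun z =>
    Fin.append (fun j => ∑ i, ((dirAinv v)⁻¹ j i : ℝ) * z (Fin.castAdd 0 i))
      (fun i => z (Fin.natAdd (1 + 2) i)) with hΦdef
  have hΦΨ : ∀ w, Φ (Ψ w) = w := fun w => baseSub_inv _ _ hA' hA w
  have hΨc : Continuous Ψ := by
    refine continuous_pi fun l => ?_
    refine Fin.addCases (fun j => ?_) (fun i => ?_) l
    · simp only [hΨdef, Fin.append_left]; fun_prop
    · simp only [hΨdef, Fin.append_right]; fun_prop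
  have hform : ∀ j w, affF 2 0 (L' j) w =
      ∑ i, ((L j).1 i : ℝ) * (Ψ w) (Fin.castAdd 0 i) + ((L j).2 : ℝ) := fun j w => by
    rw [hL']; exact (form_sub (dirAinv v) (L j) w).symm
  have hlast : ∀ j, (L' j).1 (Fin.last 2) = ∑ i, (L j).1 i * v i := fun j => by
    rw [hL']; exact vecMul_dirAinv_last _ _
  -- the reference set: the preimage of the closed input cell
  set K₀ : Set (Fin (1 + 2 + 0) → ℝ) := {w | Ψ w ∈ closure s.domain} with hK₀
  have hK₀c : IsClosed K₀ := isClosed_closure.preimage hΨc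
  have hsK₀ : closure s'.domain ⊆ K₀ :=
    closure_minimal (fun w hw => subset_closure (hsub ((hΨ w).1 hw))) hK₀c
  -- the grid dissection and the contact-aware engine on the transformed piece
  have key : ∃ c' ∈ AddSubgroup.closure (GGset 2 1 0), KZ.of s' - c' ∈ KZ.relations := by
    refine SepThree.grid hHI₃ s' M' L' e p' a' lo' hi' hbd' hdom' hint' (fun j he hLj => ?_)
      (fun j hα he w hw => ?_) (fun j j' hα hα' he he' hne => ?_) K₀ hsK₀ (fun j hα he => ?_)
    · -- every active non-constant letter is a `y`-letter
      rw [hlast]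
      refine hactv j he fun h0 => hLj ?_
      rw [hL', h0]
      simp
    · -- active `y`-letters do not vanish on the piece
      rw [hlast] at hα
      rw [hform]
      exact hpolev j hα he _ ((hΨ w).1 hw)
    · -- the ratio condition
      rw [hlast] at hα hα'
      have hne' : (∑ i, (L j').1 i * v i) • L j ≠ (∑ i, (L j).1 i * v i) • L j' := fun h => by
        refine hne ?_
        rw [hlast, hlast, hL', hL']
        have h2 := congrArg (fun c : (Fin (1 + 2) → ℚ) × ℚ => (Matrix.vecMul c.1 (dirAinv v), c.2)) h
        simpa only [Prod.smul_fst, Prod.smul_snd, Matrix.smul_vecMul, Prod.smul_mk] using h2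
      obtain ⟨C, hC⟩ := hratv j j' hα hα' he he' hne'
      refine ⟨C, fun w hw => ?_⟩
      have h := hC _ ((hΨ w).1 hw)
      rw [hform, hform, hlast, hlast]
      exact h
    · -- thin contacts, transported
      obtain ⟨P, u, hPu⟩ := hthin j he
      refine ⟨Φ P, Φ u, fun w hw h0 => ?_⟩
      rw [hform] at h0
      obtain ⟨t, ht⟩ := hPu (Ψ w) hw h0
      refine ⟨t, ?_⟩
      rw [← hΦΨ w, ht]
      exact baseSub_line _ P u t
  obtain ⟨c', hc', hr⟩ := key
  refine ⟨c', hc', ?_⟩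
  have := add_mem hrel' hr
  rwa [sub_add_sub_cancel] at this


open SeparatePos in
/-- **`stub_separateThreeZero` for THIN data, modulo `hHI₃`, in the stub's vocabulary** (`GG`
through `hGG` as in the stub). -/
theorem separateThreeZero_of_hI3_thin_GG (GG : ℕ → ℕ → ℕ → Set KZ.FormalRep) (hGG : ∀ b σ k, GG b σ k = {w : KZ.FormalRep | ∃ (m m' n₁ n₂ : ℕ) (s : KZ.IntegralRep (b + 1 + k)) (M : Fin m' → (Fin (b + 1) → ℚ) × ℚ) (L : Fin m → (Fin b → ℚ) × ℚ) (e : Fin m → ℕ) (p : MvPolynomial (Fin b) ℚ) (ℓ₁ ℓ₂ : (Fin b → ℚ) × ℚ) (a : Fin k → Option ((Fin (b + 1) → ℚ) × ℚ)) (lo hi : Fin k → Fin k ⊕ ((Fin (b + 1) → ℚ) × ℚ)), (n₁ = 0 ∨ n₂ = 0) ∧ (σ = 2 → (∀ i c, a i = some c → c.1 (Fin.last b) = 0) ∧ (∀ i c, (lo i = Sum.inr c ∨ hi i = Sum.inr c) → (c.1 (Fin.last b) = 0 ∨ c = (Pi.single (Fin.last b) 1, 0)))) ∧ Bornology.IsBounded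 s.domain ∧ s.domain = {z | (∀ j, 0 < ∑ i, ((M j).1 i : ℝ) * z (Fin.castAdd k i) + ((M j).2 : ℝ)) ∧ ∀ i, Sum.elim (fun j => z (Fin.natAdd (b + 1) j)) (fun c => ∑ i', (c.1 i' : ℝ) * z (Fin.castAdd k i') + (c.2 : ℝ)) (lo i) < z (Fin.natAdd (b + 1) i) ∧ z (Fin.natAdd (b + 1) i) < Sum.elim (fun j => z (Fin.natAdd (b + 1) j)) (fun c => ∑ i', (c.1 i' : ℝ) * z (Fin.castAdd k i') + (c.2 : ℝ)) (hi i)} ∧ EqOn s.integrand (fun z => MvPolynomial.aeval (fun i => z (Fin.castAdd k (Fin.castSucc i))) p / (∏ j, (∑ i, ((L j).1 i : ℝ) * z (Fin.castAdd k (Fin.castSucc i)) + ((L j).2 : ℝ)) ^ e j) * ((z (Fin.castAdd k (Fin.last b)) - (∑ i, (ℓ₁.1 i : ℝ) * z (Fin.castAdd k (Fin.castSucc i)) + (ℓ₁.2 : ℝ))) ^ n₁ / (z (Fin.castAdd k (Fin.last b)) - (∑ i, (ℓ₂.1 i : ℝ) * z (Fin.castAdd k (Fin.castSucc i)) + (ℓ₂.2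 : ℝ))) ^ n₂) * ∏ i, (a i).elim 1 (fun c => 1 / (z (Fin.natAdd (b + 1) i) - (∑ i', (c.1 i' : ℝ) * z (Fin.castAdd k i') + (c.2 : ℝ))))) s.domain ∧ w = KZ.of s}) (hHI₃ : ∀ (b k m m' n : ℕ) (s : KZ.IntegralRep (b + 1 + k)) (M : Fin m' → (Fin (b + 1) → ℚ) × ℚ) (L : Fin m → (Fin b → ℚ) × ℚ) (e : Fin m → ℕ) (p : MvPolynomial (Fin (b + 1)) ℚ) (ℓ : (Fin b → ℚ) × ℚ) (a : Fin k → Option ((Fin (b + 1) → ℚ) × ℚ)) (lo hi : Fin k → Fin k ⊕ ((Fin (b + 1) → ℚ) × ℚ)) (hpole : n ≠ 0 → ∀ z ∈ s.domain, (z (Fin.castAdd k (Fin.last b)) - (∑ i, (ℓ.1 i : ℝ) * z (Fin.castAdd k (Fin.castSucc i)) + (ℓ.2 : ℝ))) ≠ 0) (hbd : Bornology.IsBounded s.domain) (hdom : s.domain = {z | (∀ j, 0 < ∑ i, ((M j).1 i : ℝ) * z (Fin.castAdd k i) + ((M j).2 : ℝ)) ∧ ∀ i, Sum.elim (fun j =>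 z (Fin.natAdd (b + 1) j)) (fun c => ∑ i', (c.1 i' : ℝ) * z (Fin.castAdd k i') + (c.2 : ℝ)) (lo i) < z (Fin.natAdd (b + 1) i) ∧ z (Fin.natAdd (b + 1) i) < Sum.elim (fun j => z (Fin.natAdd (b + 1) j)) (fun c => ∑ i', (c.1 i' : ℝ) * z (Fin.castAdd k i') + (c.2 : ℝ)) (hi i)}) (hint : EqOn s.integrand (fun z => MvPolynomial.aeval (fun i => z (Fin.castAdd k i)) p / (∏ j, (∑ i, ((L j).1 i : ℝ) * z (Fin.castAdd k (Fin.castSucc i)) + ((L j).2 : ℝ)) ^ e j) * (1 / (z (Fin.castAdd k (Fin.last b)) - (∑ i, (ℓ.1 i : ℝ) * z (Fin.castAdd k (Fin.castSucc i)) + (ℓ.2 : ℝ))) ^ n) * ∏ i, (a i).elim 1 (fun c => 1 / (z (Fin.natAdd (b + 1) i) - (∑ i', (c.1 i' : ℝ) * z (Fin.castAdd k i') + (c.2 : ℝ))))) s.domain) (N : ℕ) (q : ℕ → MvPolynomial (Fin b) ℚ) (hq : ∀ z : Fin (b + 1 + k) → ℝ, MvPolynomial.aeval (fun i => z (Fin.castAdd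 k i)) p = ∑ i ∈ Finset.range N, MvPolynomial.aeval (fun i => z (Fin.castAdd k (Fin.castSucc i))) (q i) * (z (Fin.castAdd k (Fin.last b)) - (∑ i, (ℓ.1 i : ℝ) * z (Fin.castAdd k (Fin.castSucc i)) + (ℓ.2 : ℝ))) ^ i) (hb : b = 2) (hk : k = 0) (hR : ∀ z ∈ closure s.domain, (∃ j, e j ≠ 0 ∧ (∑ i, ((L j).1 i : ℝ) * z (Fin.castAdd k (Fin.castSucc i)) + ((L j).2 : ℝ)) = 0) → (n ≠ 0 ∧ z (Fin.castAdd k (Fin.last b)) = ∑ i, (ℓ.1 i : ℝ) * z (Fin.castAdd k (Fin.castSucc i)) + (ℓ.2 : ℝ)) ∨ (∃ z' ∈ closure s.domain, z' ≠ z ∧ ∀ i : Fin b, z' (Fin.castAdd k (Fin.castSucc i)) = z (Fin.castAdd k (Fin.castSucc i)))), ∀ i ∈ Finset.range N, IntegrableOn (fun z => MvPolynomial.aeval (fun i => z (Fin.castAdd k (Fin.castSucc i))) (q i) / (∏ j, (∑ i, ((L j).1 i : ℝ) * z (Fin.castAdd k (Fin.castSucc i)) + ((L j).2 : ℝ)) ^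 e j) * ((z (Fin.castAdd k (Fin.last b)) - (∑ i, (ℓ.1 i : ℝ) * z (Fin.castAdd k (Fin.castSucc i)) + (ℓ.2 : ℝ))) ^ i / (z (Fin.castAdd k (Fin.last b)) - (∑ i, (ℓ.1 i : ℝ) * z (Fin.castAdd k (Fin.castSucc i)) + (ℓ.2 : ℝ))) ^ n) * ∏ i, (a i).elim 1 (fun c => 1 / (z (Fin.natAdd (b + 1) i) - (∑ i', (c.1 i' : ℝ) * z (Fin.castAdd k i') + (c.2 : ℝ))))) s.domain) (m m' : ℕ) (s : KZ.IntegralRep (3 + 0)) (M : Fin m' → (Fin 3 → ℚ) × ℚ) (L : Fin m → (Fin 3 → ℚ) × ℚ) (e : Fin m → ℕ) (p : MvPolynomial (Fin 3) ℚ) (a : Fin 0 → Option ((Fin 3 → ℚ) × ℚ)) (lo hi : Fin 0 → Fin 0 ⊕ ((Fin 3 → ℚ) × ℚ)) (hbd : Bornology.IsBounded s.domain) (hdom : s.domain = {z | (∀ j, 0 < ∑ i, ((M j).1 i : ℝ) * z (Fin.castAdd 0 i) + ((M j).2 : ℝ)) ∧ ∀ i, Sum.elim (fun j => z (Fin.natAdd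 3 j)) (fun c => ∑ i', (c.1 i' : ℝ) * z (Fin.castAdd 0 i') + (c.2 : ℝ)) (lo i) < z (Fin.natAdd 3 i) ∧ z (Fin.natAdd 3 i) < Sum.elim (fun j => z (Fin.natAdd 3 j)) (fun c => ∑ i', (c.1 i' : ℝ) * z (Fin.castAdd 0 i') + (c.2 : ℝ)) (hi i)}) (hint : EqOn s.integrand (fun z => MvPolynomial.aeval (fun i => z (Fin.castAdd 0 i)) p / (∏ j, (∑ i, ((L j).1 i : ℝ) * z (Fin.castAdd 0 i) + ((L j).2 : ℝ)) ^ e j) * ∏ i, (a i).elim 1 (fun c => 1 / (z (Fin.natAdd 3 i) - (∑ i', (c.1 i' : ℝ) * z (Fin.castAdd 0 i') + (c.2 : ℝ))))) s.domain) (hthin : ∀ j, e j ≠ 0 → ∃ P u : Fin (3 + 0) → ℝ, ∀ z ∈ closure s.domain, (∑ i, ((L j).1 i : ℝ) * z (Fin.castAdd 0 i) + ((L j).2 : ℝ)) = 0 → ∃ t : ℝ, z = P + t • u) : ∃ c ∈ AddSubgroup.closure (GG 2 1 0), KZ.of s - c ∈ KZ.relations := by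
  rw [show GG 2 1 0 = GGset 2 1 0 from hGG 2 1 0]
  exact separateThreeZero_of_hI3_thin hHI₃ m m' s M L e p a lo hi hbd hdom hint hthin

end Summit.KontsevichZagierPeriods.ArrangementNormalForm.JanusBands
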